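import Mathlib

/-!
# Packing bound for ordered escape ladders in `ZMod m` (support file)

Item `stmt-MatrixMultiplication-14308` (`FourierTwoFamiliesModP.PrimeTwoFamilies`, CKSU 2005
Conj. 4.7 with prime cyclic hosts), line Sketch, stub `ladder_card_mul_sqrt_le`.

An ORDERED ESCAPE LADDER in `ZMod m` is a family of `r` classes `(X c, Y c)`, `c : Fin r`, such that
for classes `p < q` every lower cross difference `y' - x'` (`x' ∈ X p`, `y' ∈ Y q`) differs from
every diagonal difference `y - x` (`x ∈ X c`, `y ∈ Y c`, any class `c`) — hypothesis `hL`.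

THE PACKING BOUND (`ladder_card_mul_sqrt_le`): if every class has co-volume
`|X c| * |Y c| ≥ P > 0`, then `r * √P ≤ m`.  Proof: taking `c = q` (resp. `c = p`) in `hL` and the
trivial coincidence `y - x = y - x` shows that the `X c` are pairwise disjoint and the `Y c` are
pairwise disjoint (the partner set is non-empty because `P > 0`), so `∑ c (|X c| + |Y c|) ≤ 2 m`;
and AM–GM gives `|X c| + |Y c| ≥ 2 √(|X c| |Y c|) ≥ 2 √P` for every class.  So the regime
`r ≥ m ^ (1/2 - ε)`, `|X c| |Y c| ≥ m ^ (1 - ε)` asked for by the cyclic ladder conjecture is the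
extremal one.
-/

-- single-conjunct summit: the mandated namespace repeats `MatrixMultiplication` (summit = sub-problem).
set_option linter.dupNamespace false

namespace Summit.MatrixMultiplication.MatrixMultiplication.Theorems.PrimeTwoFamilies.LadderLift

open Finset

/-- Both sets of a class with co-volume at least `P > 0` are non-empty. -/
private lemma nonempty_of_covol {m : ℕ} {A B : Finset (ZMod m)} {P : ℝ} (hP0 : 0 < P)
    (hP : P ≤ ((A.card * B.card : ℕ) : ℝ)) : A.Nonempty ∧ B.Nonempty := by
  have h : 0 < A.card * B.card := by exact_mod_cast hP0.trans_le hP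
  exact ⟨Finset.card_pos.1 (pos_of_mul_pos_left h (Nat.zero_le _)),
    Finset.card_pos.1 (pos_of_mul_pos_right h (Nat.zero_le _))⟩

/-- In an ordered escape ladder whose `Y`-sets are non-empty, the `X`-sets are pairwise disjoint:
a common point `x₀ ∈ X p ∩ X q` (`p < q`) and any `y₀ ∈ Y q` violate `hL` at `c = q`. -/
private lemma pairwiseDisjoint_X {m r : ℕ} (X Y : Fin r → Finset (ZMod m))
    (hL : ∀ c p q : Fin r, p < q → ∀ x ∈ X c, ∀ y ∈ Y c, ∀ x' ∈ X p, ∀ y' ∈ Y q, y - x ≠ y' - x')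
    (hY : ∀ c, (Y c).Nonempty) :
    ((univ : Finset (Fin r)) : Set (Fin r)).PairwiseDisjoint X := by
  have key : ∀ p q : Fin r, p < q → Disjoint (X p) (X q) := by
    intro p q hpq
    rw [Finset.disjoint_left]
    intro x hxp hxq
    obtain ⟨y, hy⟩ := hY q
    exact hL q p q hpq x hxq y hy x hxp y hy rfl
  intro p _ q _ hpq
  rcases lt_or_gt_of_ne hpq with h | h
  · exact key p q h
  · exact (key q p h).symm

/-- In an ordered escape ladder whose `X`-sets are non-empty, the `Y`-sets are pairwise disjoint:
a common point `y₀ ∈ Y p ∩ Y q` (`p < q`) and any `x₀ ∈ X p` violate `hL` at `c = p`. -/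
private lemma pairwiseDisjoint_Y {m r : ℕ} (X Y : Fin r → Finset (ZMod m))
    (hL : ∀ c p q : Fin r, p < q → ∀ x ∈ X c, ∀ y ∈ Y c, ∀ x' ∈ X p, ∀ y' ∈ Y q, y - x ≠ y' - x')
    (hX : ∀ c, (X c).Nonempty) :
    ((univ : Finset (Fin r)) : Set (Fin r)).PairwiseDisjoint Y := by
  have key : ∀ p q : Fin r, p < q → Disjoint (Y p) (Y q) := by
    intro p q hpq
    rw [Finset.disjoint_left]
    intro y hyp hyq
    obtain ⟨x, hx⟩ := hX p
    exact hL p p q hpq x hx y hyp x hx y hyq rfl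
  intro p _ q _ hpq
  rcases lt_or_gt_of_ne hpq with h | h
  · exact key p q h
  · exact (key q p h).symm

/-- A pairwise disjoint `Fin r`-indexed family of subsets of `ZMod m` has total size at most `m`. -/
private lemma sum_card_le {m r : ℕ} [NeZero m] (X : Fin r → Finset (ZMod m))
    (hX : ((univ : Finset (Fin r)) : Set (Fin r)).PairwiseDisjoint X) :
    ∑ c, (X c).card ≤ m := by
  rw [← Finset.card_biUnion hX]
  exact (Finset.card_le_univ _).trans_eq (ZMod.card m)

/-- AM–GM in the form `2 √P ≤ a + b` whenever `0 ≤ P ≤ a b` with `a, b ≥ 0`. -/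
private lemma two_mul_sqrt_le_add {P a b : ℝ} (ha : 0 ≤ a) (hb : 0 ≤ b) (hP : P ≤ a * b) :
    2 * Real.sqrt P ≤ a + b := by
  have h1 : Real.sqrt P ≤ Real.sqrt a * Real.sqrt b := by
    rw [← Real.sqrt_mul ha]
    exact Real.sqrt_le_sqrt hP
  nlinarith [sq_nonneg (Real.sqrt a - Real.sqrt b), Real.sq_sqrt ha, Real.sq_sqrt hb]

/-- **Packing bound for ordered escape ladders.**  If `(X c, Y c)_{c < r}` is an ordered escape
ladder in `ZMod m` (hypothesis `hL`) all of whose classes have co-volume `|X c| * |Y c| ≥ P > 0`,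
then `r * √P ≤ m`: the `X c` are pairwise disjoint, the `Y c` are pairwise disjoint, and
`|X c| + |Y c| ≥ 2 √P` by AM–GM. -/
theorem ladder_card_mul_sqrt_le {m : ℕ} [NeZero m] {r : ℕ} (X Y : Fin r → Finset (ZMod m))
    (hL : ∀ c p q : Fin r, p < q → ∀ x ∈ X c, ∀ y ∈ Y c, ∀ x' ∈ X p, ∀ y' ∈ Y q, y - x ≠ y' - x')
    {P : ℝ} (hP0 : 0 < P) (hP : ∀ c : Fin r, P ≤ (((X c).card * (Y c).card : ℕ) : ℝ)) :
    (r : ℝ) * Real.sqrt P ≤ (m : ℝ) := by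
  have hne : ∀ c, (X c).Nonempty ∧ (Y c).Nonempty := fun c => nonempty_of_covol hP0 (hP c)
  have hX : ((univ : Finset (Fin r)) : Set (Fin r)).PairwiseDisjoint X :=
    pairwiseDisjoint_X X Y hL fun c => (hne c).2
  have hY : ((univ : Finset (Fin r)) : Set (Fin r)).PairwiseDisjoint Y :=
    pairwiseDisjoint_Y X Y hL fun c => (hne c).1
  have hsumX : ((∑ c, (X c).card : ℕ) : ℝ) ≤ m := by exact_mod_cast sum_card_le X hX
  have hsumY : ((∑ c, (Y c).card : ℕ) : ℝ) ≤ m := by exact_mod_cast sum_card_le Y hY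
  have hcls : ∀ c ∈ (univ : Finset (Fin r)),
      2 * Real.sqrt P ≤ ((X c).card : ℝ) + ((Y c).card : ℝ) := by
    intro c _
    refine two_mul_sqrt_le_add (Nat.cast_nonneg _) (Nat.cast_nonneg _) ?_
    exact_mod_cast hP c
  have hsum := Finset.sum_le_sum hcls
  rw [Finset.sum_const, Finset.card_univ, Fintype.card_fin, nsmul_eq_mul,
    Finset.sum_add_distrib] at hsum
  push_cast at hsumX hsumY
  linarith

end Summit.MatrixMultiplication.MatrixMultiplication.Theorems.PrimeTwoFamilies.LadderLift
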